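import Summits.Ventures.GridStability.Models.InverterDVOCQuotient

/-!
# GridStability/Models/InverterDVOCOrbitRoa — rung G3.c Track S: from a quotient certificate on `ℝ⁴` to «the network's voltages converge to the rest ORBIT», once and for all (`N = 2`)

Cell `gridfusion` (LADDER-GRIDFUSION, APEX LINE rung G3.c, director RULING 16 (c) / RULING 18 Track S,
lead A20: instance of record «DVOC2-GCBD19-13»; producer sos-3 (claim instance
`cert/sos-3/runs/j262640/DVOC2-GCBD19-13-deg2-instance.json`, INBOX 00:20:37Z), A sos-1, B sos-2,
Lean sos-5, -roa lyap-1, model-side transport model-3); seat gridfusion-model-3 (g3). Companion of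
`Models/InverterDVOCQuotient.lean` (p467971: invariants `r = (ρ₀, ρ₁, ξ, ζ)`, quotient field
`quotField`, `hasDerivWithinAt_invariants`, `invariants_mem_quadric`) — this file is the dVOC
analogue of `Models/InverterPLLRoa.lean` (p476750): the LAST step of the -roa sentence, generic in
the certificate, so that the per-certificate corollary is a page of `simp`/`ring` glue.

THREE COLUMNS. CERTIFIED: nothing here (the identities live in sos-5's Bench file; their ODE-level
consequence for the SHIFTED QUOTIENT system `ẋ = G̃(x)`, `G̃(x) = G(x + r⋆)`, on the shifted quadric is
lyap-1's recast theorem). MODELLED: the reduced dVOC network `InverterDVOC.DvocNetwork 2`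
[cite: SuboticEtAl2021, eq. (ss.f.vhat)] (MODEL-VALIDITY MV-6O; for «DVOC2-GCBD19-13»:
+ MV-κ(κ′) + MV-P + N2-restriction(-13), model-2 00:00:53Z). VALIDATED: nothing. No sentence here
says a converter or a grid is stable; «converges to the rest orbit» means: the rotation invariants
OF THE MODEL's state tend to their rest values `r⋆`, i.e. `‖v̂_k(t)‖² → ρ_k⋆`,
`⟨v̂₀, v̂₁⟩ → ξ⋆`, `v̂₀ ∧ v̂₁ → ζ⋆` — the state approaches the circle
`{v̂ | invariants v̂ = r⋆}` (one `ℛ(θ)`-orbit, `invariants_rotate`), which is what synchronisation at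
the dispatched operating point means for a rotation-equivariant model (`field_rotate`).

## What is proved (hypothesis = lyap-1's quotient conclusion, in the shape it can deliver)

`invariants_tendsto_of_quotient_roa`: let `W : DvocNetwork 2`, `r⋆ ∈ ℝ⁴`, `F` ANY field with
`F (r − r⋆) = quotField W r` (the Bench field is the shifted quotient field — per certificate a
`simp`/`ring` identity against the Bench `…_f_*_eq` lemmas and the instance's rational data), `M` any
set containing every shifted invariant vector `invariants v̂ − r⋆` (e.g. the shifted quadric, or its
intersection with the orthant `{x₀ + ρ₀⋆ ≥ 0, x₁ + ρ₁⋆ ≥ 0}` — sos-3's domain hypotheses — since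
`ρ_k = ‖v̂_k‖² ≥ 0`), `Vz` any function and `c` any level. IF every curve `x` on `[0, ∞)` with right
derivative `F (x t)`, `x t ∈ M` for all `t ≥ 0` and `Vz (x 0) ≤ c` satisfies `Vz (x t) ≤ c` for all
`t ≥ 0` and `x t → 0` (lyap-1, via `Lyapunov.CertificateSoundness` on `ℝ⁴`), THEN along every
solution `v̂` of the network model on `[0, ∞)` with `Vz (invariants v̂(0) − r⋆) ≤ c`: the sublevel
bound persists and `invariants v̂(t) → r⋆` (`rho_xi_zeta_tendsto_of_quotient_roa` unpacks it).
Note the `M`-hypothesis is asked FOR ALL TIMES (not only at `t = 0`): the transport supplies it for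
free (the invariant curve of a network solution lies on the quadric with `ρ_k ≥ 0` at every time),
and it spares the recast theorem an invariance argument for the orthant conjuncts.
-/

noncomputable section

open Real Set Filter Topology

namespace Summit.Ventures.GridStability.Models.InverterDVOC.DvocNetwork

/-- The invariant map `v̂ ↦ (ρ₀, ρ₁, ξ₀₁, ζ₀₁)` is continuous (polynomial). [folklore] -/
theorem continuous_invariants : Continuous (invariants : State 2 → Fin 4 → ℝ) := by
  refine continuous_pi fun i => ?_
  fin_cases i <;> simp [invariants, rho, xi, zeta] <;> fun_prop

/-- Along a network solution the invariants have nonnegative magnitude entries: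
`ρ_k = ‖v̂_k‖² ≥ 0`. [folklore] -/
theorem invariants_rho_nonneg (v : State 2) : 0 ≤ invariants v 0 ∧ 0 ≤ invariants v 1 := by
  simp only [invariants]
  exact ⟨by simp [rho]; positivity, by simp [rho]; positivity⟩

/-- **Rung G3.c Track S, model-side transport (generic in the certificate).** MODELLED: the
2-converter reduced dVOC network `W : DvocNetwork 2` [cite: SuboticEtAl2021, eq. (ss.f.vhat)];
MV-6O (+ instance modifiers). HYPOTHESES on the certificate side (all discharged per Bench file):
`F` is the quotient field shifted to the rest point `r⋆` (`F (r − r⋆) = quotField W r`); `M`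
contains every shifted invariant vector; `hroa` = lyap-1's conclusion for the shifted quotient system
on `ℝ⁴` (sublevel bound persists, `x t → 0`) for curves that stay in `M`. CONCLUSION: along every
solution `v̂` of `d v̂/dt = f^s(v̂)` on `[0, ∞)` (tree convention) whose initial invariants satisfy
`Vz (invariants v̂(0) − r⋆) ≤ c`: `Vz (invariants v̂(t) − r⋆) ≤ c` for all `t ≥ 0` and
`invariants v̂(t) → r⋆`. Chain rule = `hasDerivWithinAt_invariants` (p467971). No sentence here says
a converter is stable. [folklore] -/
theorem invariants_tendsto_of_quotient_roa (W : DvocNetwork 2) (rstar : Fin 4 → ℝ)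
    {F : (Fin 4 → ℝ) → Fin 4 → ℝ} (hF : ∀ r : Fin 4 → ℝ, F (r - rstar) = W.quotField r)
    {M : Set (Fin 4 → ℝ)} (hM : ∀ v : State 2, invariants v - rstar ∈ M)
    {Vz : (Fin 4 → ℝ) → ℝ} {c : ℝ}
    (hroa : ∀ x : ℝ → Fin 4 → ℝ, ContinuousOn x (Ici 0) →
      (∀ t, 0 ≤ t → HasDerivWithinAt x (F (x t)) (Ici t) t) → (∀ t, 0 ≤ t → x t ∈ M) →
      Vz (x 0) ≤ c → (∀ t, 0 ≤ t → Vz (x t) ≤ c) ∧ Tendsto x atTop (𝓝 0))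
    {v : ℝ → State 2} (hv : W.IsSolutionOn v (Ici 0))
    (h0 : Vz (invariants (v 0) - rstar) ≤ c) :
    (∀ t, 0 ≤ t → Vz (invariants (v t) - rstar) ≤ c) ∧
      Tendsto (fun t => invariants (v t)) atTop (𝓝 rstar) := by
  set x : ℝ → Fin 4 → ℝ := fun τ => invariants (v τ) - rstar with hxdef
  have hvc : ContinuousOn v (Ici 0) := fun t ht => (hv t ht).continuousWithinAt
  have hxc : ContinuousOn x (Ici 0) :=
    (continuous_invariants.comp_continuousOn hvc).sub continuousOn_const
  have hx : ∀ t, 0 ≤ t → HasDerivWithinAt x (F (x t)) (Ici t) t := by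
    intro t ht
    have h := ((W.hasDerivWithinAt_invariants (hv t ht)).sub_const rstar).mono
      (Ici_subset_Ici.2 ht)
    have hFt : F (x t) = W.quotField (invariants (v t)) := hF (invariants (v t))
    rw [hFt]
    exact h
  have hxM : ∀ t, 0 ≤ t → x t ∈ M := fun t _ => hM (v t)
  obtain ⟨hinv, hlim⟩ := hroa x hxc hx hxM h0
  refine ⟨hinv, ?_⟩
  have h := hlim.add_const rstar
  simp only [zero_add] at h
  refine h.congr fun t => ?_
  simp [hxdef]

/-- The same conclusion unpacked in the model's quantities: `‖v̂₀‖² → ρ₀⋆`, `‖v̂₁‖² → ρ₁⋆`,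
`⟨v̂₀, v̂₁⟩ → ξ⋆`, `v̂₀ ∧ v̂₁ → ζ⋆` — convergence to the rest ORBIT `{invariants = r⋆}` of the
rotation-equivariant model (one circle, `invariants_rotate`/`field_rotate`), the certified
inner-estimate form of the set statement of [cite: SuboticEtAl2021, Thm. 6] for the reduced model.
MODELLED: MV-6O. No stability word. [folklore] -/
theorem rho_xi_zeta_tendsto_of_quotient_roa (W : DvocNetwork 2) (rstar : Fin 4 → ℝ)
    {F : (Fin 4 → ℝ) → Fin 4 → ℝ} (hF : ∀ r : Fin 4 → ℝ, F (r - rstar) = W.quotField r)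
    {M : Set (Fin 4 → ℝ)} (hM : ∀ v : State 2, invariants v - rstar ∈ M)
    {Vz : (Fin 4 → ℝ) → ℝ} {c : ℝ}
    (hroa : ∀ x : ℝ → Fin 4 → ℝ, ContinuousOn x (Ici 0) →
      (∀ t, 0 ≤ t → HasDerivWithinAt x (F (x t)) (Ici t) t) → (∀ t, 0 ≤ t → x t ∈ M) →
      Vz (x 0) ≤ c → (∀ t, 0 ≤ t → Vz (x t) ≤ c) ∧ Tendsto x atTop (𝓝 0))
    {v : ℝ → State 2} (hv : W.IsSolutionOn v (Ici 0))
    (h0 : Vz (invariants (v 0) - rstar) ≤ c) :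
    Tendsto (fun t => rho (v t) 0) atTop (𝓝 (rstar 0)) ∧
      Tendsto (fun t => rho (v t) 1) atTop (𝓝 (rstar 1)) ∧
      Tendsto (fun t => xi (v t) 0 1) atTop (𝓝 (rstar 2)) ∧
      Tendsto (fun t => zeta (v t) 0 1) atTop (𝓝 (rstar 3)) := by
  obtain ⟨-, hlim⟩ := invariants_tendsto_of_quotient_roa W rstar hF hM hroa hv h0
  have h := tendsto_pi_nhds.1 hlim
  refine ⟨?_, ?_, ?_, ?_⟩
  · simpa [invariants] using h 0
  · simpa [invariants] using h 1
  · simpa [invariants] using h 2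
  · simpa [invariants] using h 3

end Summit.Ventures.GridStability.Models.InverterDVOC.DvocNetwork

end
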